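import Literature.NumberTheory.Automorphic.SmoothCharacter
import HarnessLib

/-!
# The constant of the `K · T · N` calibration: `C · μ_K(K) · μ_T(T ∩ K) · μ_N(N ∩ K) = ν(K)` (Rogawski 1990 §4.13 p. 70 «`dg = dk dm du`»)

Topic `NumberTheory/Automorphic`; namespace `Literature.NumberTheory.Automorphic`.  THEOREMS ONLY (no definition, no instance, no notation, no named fact,
no `sorry`).  Cell `pub/hodgecm-mathlib`, line «CMCharIdentityTest» (F0P3b `Cruxes/H413/Lines/F0_P3b_CMCharIdentityTestPaydown.lean` ED. 11), desk
F0P3b-plan (g12) PLAN v14 §10 ∕ FORWARD DEAL 07:31:16Z — the «constants» clause of the S4 assembly of (N-492) `stub_inducedCharTransfer`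
[Rogawski1990 Lemma 4.9.2]: ★ S1 `UnitaryGroup.exists_smoothTrace_cmPrincipalSeries_eq_integral_torus` (p842217) and ★ S2 produce a constant `C > 0`
pinned only through the calibration `∫_G F dν = C ∫_K ∫_T ∫_N F(t n k) dμ_N dμ_T dμ_K`; S0 (★ p842181 `coe_eq_measure_div_of_quotientMeasure_eq_smul_map`)
pins the orbital side by `c_G = ν(K) ∕ (μ_K(K) · μ_N(N ∩ K))`.  This file reads `C` off the calibration, GENERICALLY:
* **`measureReal_eq_mul_of_integral_eq_mul_integral_KTN`** — for subgroups `T, N ≤ G`, a compact open subgroup `K` in GOOD POSITION w.r.t. `(T, N)`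
  (`t n ∈ K → t ∈ K` for `t ∈ T`, `n ∈ N`; e.g. `K_v` and the Borel pair, ★ `mem_cmLocalIntegralLevel_of_torus_mul_unipotent`), any measures
  `ν, μ_K, μ_T, μ_N`, and any real `C` satisfying the calibration on continuous compactly supported `F`:
  `ν.real K = C · μ_K.real univ · μ_T.real (T ∩ K) · μ_N.real (N ∩ K)` (test `F = 1_K`: `1_K(t n k) = 1_K(t n) = 1_{T∩K}(t) · 1_{N∩K}(n)` for `k ∈ K`).
  Hence `C = c_G ∕ μ_T.real(T ∩ K)`: the torus measure that S4 integrates against is `μ_T ∕ μ_T(T ∩ K)`, of mass one on `T ∩ K`.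
HONEST LABEL: HC_CM is proved only modulo the printed citations (2 remaining named inputs hLiu418, h413) until rung 0 closes; this file pays no letter by itself.

## References
* [Rogawski1990] J. D. Rogawski, *Automorphic Representations of Unitary Groups in Three Variables* (1990), §4.13 p. 70; §4.3 (4.3.1) p. 43.
* [Gelbart1975] S. Gelbart, *Automorphic Forms on Adele Groups* (1975), Thm. 9.22 (iii).
-/

set_option autoImplicit false

noncomputable section

open MeasureTheory MeasureTheory.Measure Topology

namespace Literature.NumberTheory.Automorphic

section Calibration

variable {G : Type*} [Group G] [TopologicalSpace G] [IsTopologicalGroup G] [MeasurableSpace G] [BorelSpace G]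

/-- **The constant of the `K · T · N` calibration**: if `∫_G F dν = C ∫_K ∫_T ∫_N F(t n k) dμ_N dμ_T dμ_K` for all continuous compactly supported `F`, `K` is a compact
open subgroup and `t n ∈ K → t ∈ K` for `t ∈ T`, `n ∈ N` (good position), then `ν.real K = C · μ_K.real univ · μ_T.real (T ∩ K) · μ_N.real (N ∩ K)`
(test function `1_K`). [cite: Rogawski1990, §4.13 p. 70] [cite: Gelbart1975, Thm. 9.22 (iii)] -/
theorem measureReal_eq_mul_of_integral_eq_mul_integral_KTN
    {KU T N : Subgroup G} (hKUo : IsOpen (KU : Set G)) (hKUc : IsCompact (KU : Set G))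
    (hKP : ∀ t ∈ T, ∀ n ∈ N, t * n ∈ KU → t ∈ KU)
    (ν : Measure G) (μK : Measure ↥KU) (μT : Measure ↥T) (μN : Measure ↥N) {C : ℝ}
    (hcal : ∀ F : G → ℂ, Continuous F → HasCompactSupport F →
      ∫ g, F g ∂ν = C * ∫ k : ↥KU, ∫ t : ↥T, ∫ n : ↥N, F ((t : G) * n * k) ∂μN ∂μT ∂μK) :
    ν.real (KU : Set G) = C * (μK.real Set.univ * (μT.real {t : ↥T | (t : G) ∈ KU} * μN.real {n : ↥N | (n : G) ∈ KU})) := by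
  have hlev : IsLevel KU ((KU : Set G).indicator fun _ => (1 : ℂ)) := IsLevel.indicator hKUo hKUc
  have hF := hcal _ hlev.isLocallyConstant.continuous (indicator_mem_schwartzBruhat hKUo hKUc).2
  have hTm : MeasurableSet {t : ↥T | (t : G) ∈ KU} := measurable_subtype_coe hKUo.measurableSet
  have hNm : MeasurableSet {n : ↥N | (n : G) ∈ KU} := measurable_subtype_coe hKUo.measurableSet
  -- left-hand side
  have hL : ∫ g, (KU : Set G).indicator (fun _ => (1 : ℂ)) g ∂ν = (ν.real (KU : Set G) : ℂ) := by
    rw [integral_indicator_const _ hKUo.measurableSet, Complex.real_smul, mul_one]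
  -- the integrand on `K × T × N`
  have hpt : ∀ (k : ↥KU) (t : ↥T) (n : ↥N), (KU : Set G).indicator (fun _ => (1 : ℂ)) ((t : G) * n * k) =
      {t : ↥T | (t : G) ∈ KU}.indicator (fun _ => (1 : ℂ)) t * {n : ↥N | (n : G) ∈ KU}.indicator (fun _ => (1 : ℂ)) n := by
    intro k t n
    by_cases ht : (t : G) ∈ KU
    · by_cases hn : (n : G) ∈ KU
      · rw [Set.indicator_of_mem (KU.mul_mem (KU.mul_mem ht hn) k.2), Set.indicator_of_mem (show t ∈ {t : ↥T | (t : G) ∈ KU} from ht),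
          Set.indicator_of_mem (show n ∈ {n : ↥N | (n : G) ∈ KU} from hn), mul_one]
      · have h : (t : G) * n * k ∉ (KU : Set G) := fun h =>
          hn (by simpa using KU.mul_mem (KU.inv_mem ht) (KU.mul_mem h (KU.inv_mem k.2)))
        rw [Set.indicator_of_notMem h, Set.indicator_of_notMem (show n ∉ {n : ↥N | (n : G) ∈ KU} from hn), mul_zero]
    · have h : (t : G) * n * k ∉ (KU : Set G) := fun h =>
        ht (hKP t t.2 n n.2 (by simpa using KU.mul_mem h (KU.inv_mem k.2)))
      rw [Set.indicator_of_notMem h, Set.indicator_of_notMem (show t ∉ {t : ↥T | (t : G) ∈ KU} from ht), zero_mul]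
  have hR : ∫ k : ↥KU, ∫ t : ↥T, ∫ n : ↥N, (KU : Set G).indicator (fun _ => (1 : ℂ)) ((t : G) * n * k) ∂μN ∂μT ∂μK =
      ((μK.real Set.univ * (μT.real {t : ↥T | (t : G) ∈ KU} * μN.real {n : ↥N | (n : G) ∈ KU}) : ℝ) : ℂ) := by
    simp only [hpt]
    have hN : ∀ t : ↥T, ∫ n : ↥N, {t : ↥T | (t : G) ∈ KU}.indicator (fun _ => (1 : ℂ)) t * {n : ↥N | (n : G) ∈ KU}.indicator (fun _ => (1 : ℂ)) n ∂μN =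
        {t : ↥T | (t : G) ∈ KU}.indicator (fun _ => (1 : ℂ)) t * (μN.real {n : ↥N | (n : G) ∈ KU} : ℂ) := by
      intro t
      rw [integral_const_mul, integral_indicator_const _ hNm, Complex.real_smul, mul_one]
    simp only [hN]
    rw [integral_const, integral_mul_const, integral_indicator_const _ hTm]
    simp only [Complex.real_smul, mul_one]
    push_cast
    ring
  rw [hL, hR] at hF
  exact_mod_cast hF

end Calibration

end Literature.NumberTheory.Automorphic

end
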